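import Literature.Topology.FourManifolds.HomotopySpheresGroupProofs
import Literature.Topology.FourManifolds.HomotopySpheresBP
import Literature.Topology.FourManifolds.ConnectedSumProofs
import Mathlib.Analysis.Convex.Contractible
import HarnessLib

/-!
# Inverses in `Θₙ`: Kervaire–Milnor's Lemmas 2.3 and 2.4, decomposed

Topic `Literature/Topology/FourManifolds`, sibling of `HomotopySpheresGroup.lean`. That file vendors
the named fact `Literature.Topology.FourManifolds.HomotopySphere.isHCobordant_sphere_of_isOrientedConnectedSum_neg` — *if the
closed oriented manifold `(P, oP)` is an oriented connected sum `Σ # (-Σ)` of a homotopy `n`-sphere,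
`n ≥ 2`, and its reverse, then `P` is h-cobordant to `𝕊ⁿ`* — citing Kervaire–Milnor's Lemmas 2.3
and 2.4, and uses it (with Smale's h-cobordism theorem) for the inverses of the group `Θₙ`. This
file organises the printed proof of that fact: it vendors the two lemmas as separate named facts,
introduces the notion they are phrased in (*`M` bounds a contractible manifold*), and proves the
bookkeeping between them, so that what remains to be proved is exactly the content of the two
printed lemmas.

## The printed proof (Kervaire–Milnor, Ann. of Math. 77 (1963), §2, pp. 506–507)

* **Lemma 2.3** (p. 506): "A simply connected manifold `M` is h-cobordant to the sphere `Sⁿ` if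
  and only if `M` bounds a contractible manifold. (Here the hypothesis of simple connectivity
  cannot be eliminated.)" Proof of `⇐` (the direction used for Thm 1.1): if `M = bW'` with `W'`
  contractible, removing the interior of an imbedded disc `Dⁿ⁺¹ ⊂ Int W'` gives a simply connected
  `W` with `bW = M + (-Sⁿ)`; comparing the homology sequences of the pairs `(Dⁿ⁺¹, Sⁿ)` and
  `(W', W)` (excision), `Sⁿ ↪ W` is a homology isomorphism, hence `Sⁿ` is a deformation retract of
  `W`; by Poincaré duality `Hₖ(W, M) ≅ Hⁿ⁺¹⁻ᵏ(W, Sⁿ) = 0`, so `M ↪ W` is a homology isomorphism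
  too, and `M` being simply connected it is a homotopy equivalence. Proof of `⇒`: fill in a disc.
* **Lemma 2.4** (p. 507): "If `M` is a homotopy sphere, then `M # (-M)` bounds a contractible
  manifold." Proof: with `i : Dⁿ → M` the disc used to form the sum, `W` is obtained from
  `(M - i(½D̊ⁿ)) × [0, π] + Sⁿ⁻¹ × H²` by identifying `i(tu) × θ` with
  `u × ((2t-1) sin θ, (2t-1) cos θ)` ("rotating `M - Int i(½Dⁿ)` through 180° around its
  boundary"); `bW = M # (-M)`, and `W` deformation retracts onto `M - Int i(½Dⁿ)`, which is
  contractible.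
* **Proof of Thm 1.1** (p. 507): "By Lemmas 2.3, 2.4, each element of `Θₙ` has an inverse" — the
  simple connectivity of `M # (-M)` required by Lemma 2.3 being the remark of p. 505 that the sum
  of two homotopy spheres is a homotopy sphere.

## The Lean decomposition

* `Literature.Topology.FourManifolds.BoundsContractible n M`: `M` bounds a contractible manifold —
  there is a null-cobordism `M = ∂W` (tree structure `Literature.Topology.FourManifolds.NullCobordism`:
  `W` a compact smooth `(n+1)`-manifold with boundary, `M ↪ W` a smooth embedding onto `∂W`) with
  `W` contractible. This is a *definition* (the two-parameter predicate in which Lemmas 2.3–2.4 are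
  phrased), not a named fact. **Proved** API: transport along diffeomorphisms
  (`BoundsContractible.of_diffeomorph`), the witness `𝕊ⁿ = ∂𝔻ⁿ⁺¹` (`boundsContractible_sphere`),
  and that the predicate is a genuine condition: it forces `M` to be compact
  (`BoundsContractible.compactSpace`) and so fails for every non-compact `M`
  (`not_boundsContractible_of_noncompactSpace`).
* Named facts (cited, not proved here): `Literature.Topology.FourManifolds.isHCobordant_sphere_of_boundsContractible`
  (Lemma 2.3, `⇐`) and `Literature.Topology.FourManifolds.boundsContractible_of_isHCobordant_sphere` (Lemma 2.3, `⇒`), combined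
  in the **proved** `isHCobordant_sphere_iff_boundsContractible_of` (Lemma 2.3 as printed);
  `Literature.Topology.FourManifolds.HomotopySphere.boundsContractible_of_isOrientedConnectedSum_neg` (Lemma 2.4, for every
  oriented connected sum `Σ # (-Σ)`, i.e. read together with the well-definedness of `#`,
  Lemma 2.1) and its existential form
  `Literature.Topology.FourManifolds.HomotopySphere.exists_isOrientedConnectedSum_neg_boundsContractible` (Lemma 2.4 for the one
  sum constructed in its proof), from which the former follows (**proved**,
  `boundsContractible_of_isOrientedConnectedSum_neg_of_exists`) GIVEN the Palais–Cerf uniqueness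
  of oriented connected sums (tree fact
  `Literature.Topology.FourManifolds.exists_diffeomorph_isOrientationPreserving_of_isOrientedConnectedSum`, Lemma 2.1).
* **Proved**: an (oriented) connected sum of two homotopy `n`-spheres, `n ≥ 3`, is simply
  connected (`HomotopySphere.simplyConnectedSpace_of_isConnectedSum`, from the tree theorem
  `IsConnectedSum.simplyConnectedSpace_holds`); and the assembly
  `HomotopySphere.isHCobordant_sphere_of_isOrientedConnectedSum_neg_of'`: the target fact follows
  from Lemma 2.3 (`⇐`), Lemma 2.4 and — for `n = 2` only, where Seifert–van Kampen does not apply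
  to the punctured summands — the simple connectivity of the `2`-dimensional sums `Σ # (-Σ)`,
  which `…_neg_of` takes from the p. 505 remark
  (`HomotopySphere.nonempty_homotopyEquiv_sphere_of_isConnectedSum`); for `n ≥ 3` no third input
  is needed (`HomotopySphere.isHCobordant_sphere_of_isOrientedConnectedSum_neg_of_three_le`).

* One level down (named facts, cited to the printed proofs, pp. 506–507), separating in each
  lemma the smooth construction from the homotopy theory:
  `NullCobordism.exists_cobordism_sphere_compl_ball` (removing an open ball from `Int W'` gives a
  cobordism `(W; M, 𝕊ⁿ)`, with a homeomorphism `W ≅ W' ∖ i(B̊ⁿ⁺¹)`),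
  `NullCobordism.isHomotopyEquiv_compl_ball_of_contractibleSpace` (for `W'` contractible and
  `M = ∂W'` simply connected, `n ≥ 2`, both ends of that cobordism are homotopy equivalences:
  excision, Poincaré duality, Whitehead),
  `HomotopySphere.exists_nullCobordism_isOrientedConnectedSum_neg` (the rotation construction:
  some `Σ # (-Σ)` bounds a `W ≃ₕ Σ ∖ {p}`) and `HomotopySphere.contractibleSpace_compl_singleton`
  (`Σ ∖ {p}` is contractible, `n ≥ 2`); **proved**: Lemma 2.3 (`⇐`) from the first two
  (`isHCobordant_sphere_of_boundsContractible_of`) and the existential Lemma 2.4 from the last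
  two (`HomotopySphere.exists_isOrientedConnectedSum_neg_boundsContractible_of`). Hence the
  target fact is reduced to: two smooth constructions, two homotopy-theoretic statements whose
  common missing input is Whitehead's theorem, the Palais–Cerf uniqueness of `#` (tree fact),
  and (for `n = 2`) the p. 505 remark.

Dimensions. The target fact is stated for `n ≥ 2`, and so are the lemmas here. Kervaire–Milnor
print no dimension restriction in Lemmas 2.3–2.4; for `n ≤ 1` Lemma 2.3 is vacuous (no closed
curve is simply connected, and a point is not the boundary of a compact `1`-manifold) and the
printed proof of `⇐` uses `n ≥ 2` (removing a disc from the simply connected `W'` keeps it simply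
connected only in dimension `n + 1 ≥ 3`), so nothing of the source is lost in the range where it
is used (Thm 1.1 concerns `Θₙ`, and `Θ₁ = 0` is treated separately on p. 507).

What remains for a proof of the two lemmas (not in Mathlib, not yet in the tree): Whitehead's
theorem (a homology isomorphism between simply connected spaces of the homotopy type of CW
complexes is a homotopy equivalence), excision for the pair `(W', W)` and Poincaré–Lefschetz
duality for `(W; M, Sⁿ)` on the algebraic side; the rotation construction of Lemma 2.4 and the
removal of an open ball from the interior of a manifold with boundary on the smooth side.

## References

* M. Kervaire, J. Milnor, *Groups of homotopy spheres I*, Ann. of Math. (2) 77 (1963), 504–537: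
  §2, Lemma 2.3 (p. 506), Lemma 2.4 (p. 507), proof of Thm 1.1 (p. 507), remark p. 505.
  doi:10.2307/1970128 [KervaireMilnorAnnals1963]
* J. Milnor, *Lectures on the h-cobordism theorem*, Princeton (1965), §1 (cobordisms,
  `bW`). [MilnorHCobordism1965]
* J. Cerf, *Topologie de certains espaces de plongements*, Bull. SMF 89 (1961) (disc theorem,
  with Palais 1960). [Cerf1961]
-/

open scoped Manifold ContDiff Topology ContinuousMap
open Set Module

noncomputable section

namespace Literature.Topology.FourManifolds

/-- Local notation: `𝔼 n` is the model Euclidean space `EuclideanSpace ℝ (Fin n)`. -/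
local notation "𝔼 " n:arg => EuclideanSpace ℝ (Fin n)

/-- Local notation: `𝕊 n` is the unit sphere in `EuclideanSpace ℝ (Fin (n + 1))`, the standard
`n`-sphere with its Mathlib analytic manifold structure. -/
local notation "𝕊 " n:arg => (Metric.sphere (0 : EuclideanSpace ℝ (Fin (n + 1))) 1)

/-- Local notation: `𝔻 n` is the closed unit ball in `EuclideanSpace ℝ (Fin n)`, a compact smooth
manifold with boundary (`ClosedBall.lean`). -/
local notation "𝔻 " n:arg => (Metric.closedBall (0 : EuclideanSpace ℝ (Fin n)) 1)

universe u

/-! ### Bounding a contractible manifold -/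

section BoundsContractible

variable {n : ℕ} {M M' : Type u} [TopologicalSpace M] [ChartedSpace (𝔼 n) M]
  [TopologicalSpace M'] [ChartedSpace (𝔼 n) M']

/-- `M` **bounds a contractible manifold**: there is a compact smooth `(n+1)`-manifold with
boundary `W` with `∂W = M` — a null-cobordism of `M`, tree structure `Literature.Topology.FourManifolds.NullCobordism` — whose
total space is contractible. Kervaire–Milnor, *Groups of homotopy spheres I* (1963), Lemma 2.3
(p. 506): "… if and only if `M` bounds a contractible manifold", Lemma 2.4 (p. 507); `bW` is the
boundary of `W` (§1). As for `NullCobordism`, no smoothness is imposed on `M` (for a non-smooth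
atlas no null-cobordism exists) and orientations play no role.
This is a *definition* — the condition on `M` in which Kervaire–Milnor phrase Lemmas 2.3 and 2.4,
a predicate in `(n, M)` — not a theorem: it fails e.g. for every non-compact `M`, since `M ≅ ∂W`
is closed in the compact `W` (`not_boundsContractible_of_noncompactSpace`), and holds for
`M = 𝕊ⁿ = ∂𝔻ⁿ⁺¹` (`boundsContractible_sphere`). The binders `(n M)` are written on the
declaration (rather than supplied by `variable (n M) in`) so that the statement reads as the
two-parameter predicate it is, as for the sibling `Literature.Topology.FourManifolds.BoundsParallelizable`;
the elaborated signature is unchanged. [cite: KervaireMilnorAnnals1963, §2, Lemmas 2.3–2.4 (pp. 506–507)] -/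
def BoundsContractible (n : ℕ) (M : Type u) [TopologicalSpace M] [ChartedSpace (𝔼 n) M] :
    Prop :=
  ∃ c : NullCobordism.{u} n M, ContractibleSpace c.W

/-- Unfolding of `BoundsContractible` (Kervaire–Milnor 1963, Lemma 2.3). [cite: KervaireMilnorAnnals1963, Lemma 2.3 (p. 506)] -/
theorem boundsContractible_iff :
    BoundsContractible n M ↔ ∃ c : NullCobordism.{u} n M, ContractibleSpace c.W :=
  Iff.rfl

/-- A null-cobordism with contractible total space witnesses `BoundsContractible`
(Kervaire–Milnor 1963, Lemma 2.3). [cite: KervaireMilnorAnnals1963, Lemma 2.3 (p. 506)] -/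
theorem NullCobordism.boundsContractible (c : NullCobordism.{u} n M) [h : ContractibleSpace c.W] :
    BoundsContractible n M :=
  ⟨c, h⟩

/-- **A manifold which bounds a compact manifold is compact**: if `M = ∂W` is a null-cobordism
(tree structure `NullCobordism`: `W` compact, `M ↪ W` a topological embedding onto `∂W`), then
`M` is compact, since the boundary `∂W` of the `C^∞` manifold with boundary `W` is closed
(Mathlib's `ModelWithCorners.isClosed_boundary`), hence compact, and `M ≅ ∂W`. Milnor, *Lectures
on the h-cobordism theorem* (1965), §1 (the ends `V₀, V₁` of a triad are closed manifolds). [folklore] -/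
theorem NullCobordism.compactSpace_of (c : NullCobordism.{u} n M) : CompactSpace M := by
  have hc : IsCompact ((𝓡∂ (n + 1)).boundary c.W) :=
    ((𝓡∂ (n + 1)).isClosed_boundary (M := c.W) (n := ∞) (by simp)).isCompact
  rw [← c.range_incl, ← image_univ] at hc
  exact ⟨c.isSmoothEmbedding_incl.isEmbedding.isCompact_iff.mpr hc⟩

/-- **A manifold bounding a contractible manifold is compact** (`NullCobordism.compactSpace_of`:
`M ≅ ∂W` is closed in the compact `W`). This is why `BoundsContractible` is a condition on `M`
and not a theorem. [folklore] -/
theorem BoundsContractible.compactSpace (h : BoundsContractible n M) : CompactSpace M := by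
  obtain ⟨c, -⟩ := h
  exact c.compactSpace_of

/-- **The predicate `BoundsContractible` fails for every non-compact `M`** (e.g. `M = ℝⁿ`,
`n ≥ 1`): a bounding manifold is compact (`BoundsContractible.compactSpace`). Witness that
`BoundsContractible n M` is a genuine two-parameter predicate — Kervaire–Milnor's condition in
Lemma 2.3 (1963, p. 506) — and not a provable closed statement. [folklore] -/
theorem not_boundsContractible_of_noncompactSpace [NoncompactSpace M] : ¬BoundsContractible n M :=
  fun h => not_compactSpace_iff.mpr ‹NoncompactSpace M› h.compactSpace

/-- **Bounding a contractible manifold is invariant under diffeomorphism**: if `M = ∂W` with `W`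
contractible and `φ : M ≅ M'`, then `M' = ∂W` via `incl ∘ φ⁻¹` (`NullCobordism.comap`, same total
space; direction as in `BoundsParallelizable.of_diffeomorph`). Kervaire–Milnor 1963, §1 ("the relation of h-cobordism is implied by diffeomorphism") with
Lemma 2.3. [cite: KervaireMilnorAnnals1963, §1 and Lemma 2.3 (p. 506)] -/
theorem BoundsContractible.of_diffeomorph [IsManifold (𝓡 n) ∞ M] [IsManifold (𝓡 n) ∞ M']
    (h : BoundsContractible n M) (φ : M ≃ₘ⟮𝓡 n, 𝓡 n⟯ M') : BoundsContractible n M' := by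
  obtain ⟨c, hc⟩ := h
  exact ⟨c.comap φ.symm, hc⟩

/-- Diffeomorphic manifolds simultaneously bound contractible manifolds (Kervaire–Milnor 1963,
§1 with Lemma 2.3). [cite: KervaireMilnorAnnals1963, §1 and Lemma 2.3 (p. 506)] -/
theorem boundsContractible_iff_of_diffeomorph [IsManifold (𝓡 n) ∞ M] [IsManifold (𝓡 n) ∞ M']
    (φ : M ≃ₘ⟮𝓡 n, 𝓡 n⟯ M') : BoundsContractible n M ↔ BoundsContractible n M' :=
  ⟨fun h => h.of_diffeomorph φ, fun h => h.of_diffeomorph φ.symm⟩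

end BoundsContractible

/-- **`𝕊ⁿ` bounds a contractible manifold**, namely the closed ball: `𝕊ⁿ = ∂𝔻ⁿ⁺¹`
(tree null-cobordism `NullCobordism.closedBall n`, `ClosedBall.lean`) and `𝔻ⁿ⁺¹` is convex, hence
contractible (Mathlib `Convex.contractibleSpace`). This is the trivial case `M = Sⁿ` of
Kervaire–Milnor's Lemma 2.3 (`Sⁿ` is h-cobordant to itself) and the non-vacuity witness for
`BoundsContractible`. [cite: KervaireMilnorAnnals1963, Lemma 2.3 (p. 506), proof ("filling in a disk Dⁿ⁺¹")] -/
theorem boundsContractible_sphere (n : ℕ) : BoundsContractible n (𝕊 n) := by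
  refine ⟨NullCobordism.closedBall n, ?_⟩
  show ContractibleSpace (𝔻 (n + 1))
  exact (convex_closedBall (0 : 𝔼 (n + 1)) 1).contractibleSpace
    ⟨0, Metric.mem_closedBall_self zero_le_one⟩

/-! ### Named facts: Kervaire–Milnor's Lemma 2.3 -/

/-- **Kervaire–Milnor's Lemma 2.3, direction `⇐` (the one used for Theorem 1.1).** Kervaire–Milnor,
*Groups of homotopy spheres I*, Ann. of Math. 77 (1963), Lemma 2.3, p. 506: "A simply connected
manifold `M` is h-cobordant to the sphere `Sⁿ` if and only if `M` bounds a contractible manifold.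
(Here the hypothesis of simple connectivity cannot be eliminated.)" Here: a closed (compact,
Hausdorff, second countable) simply connected smooth `n`-manifold `M`, `n ≥ 2`, which bounds a
contractible compact smooth `(n+1)`-manifold (`BoundsContractible n M`) is h-cobordant to `𝕊ⁿ`
(tree notion `Literature.Topology.FourManifolds.IsHCobordant`, unoriented, as "manifold" means closed oriented smooth manifold
in Kervaire–Milnor's §1 and the orientations play no role in the conclusion used). Printed proof:
remove the interior of a smooth disc `Dⁿ⁺¹` from the interior of the contractible `W'`; the result
`W` has `bW = M + (-Sⁿ)`, `Sⁿ ↪ W` is a homology isomorphism by excision and `M ↪ W` by Poincaré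
duality `Hₖ(W, M) ≅ Hⁿ⁺¹⁻ᵏ(W, Sⁿ)`, and both are homotopy equivalences as `W`, `M`, `Sⁿ` are simply
connected. Dimension: Kervaire–Milnor print no restriction; `n ≥ 2` is what the printed proof uses
(`W` stays simply connected) and the range in which Theorem 1.1 invokes the lemma, the cases
`n ≤ 1` being vacuous (no simply connected closed curve; a point bounds no compact `1`-manifold).
`M : Type`, as the two ends of a tree `Cobordism` share a universe and `𝕊ⁿ : Type`.
[cite: KervaireMilnorAnnals1963, Lemma 2.3 (p. 506), direction ⇐] -/
def isHCobordant_sphere_of_boundsContractible : Prop :=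
  ∀ (n : ℕ) (M : Type) [TopologicalSpace M] [T2Space M] [SecondCountableTopology M]
    [ChartedSpace (𝔼 n) M] [IsManifold (𝓡 n) ∞ M] [CompactSpace M] [SimplyConnectedSpace M],
    2 ≤ n → BoundsContractible n M → IsHCobordant n M (𝕊 n)

/-- **Kervaire–Milnor's Lemma 2.3, direction `⇒`.** Kervaire–Milnor, *Groups of homotopy spheres
I* (1963), Lemma 2.3, p. 506: a closed simply connected smooth `n`-manifold `M`, `n ≥ 2`, which is
h-cobordant to `𝕊ⁿ` bounds a contractible manifold. Printed proof: "If `M + (-Sⁿ) = bW` then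
filling in a disk `Dⁿ⁺¹` we obtain a manifold `W'` with `bW' = M`. If `Sⁿ` is a deformation retract
of `W`, then it clearly follows that `W'` is contractible." The simple connectivity hypothesis is
that of the printed lemma (in this direction it also follows from `M ≃ₕ W ≃ₕ Sⁿ`, but that is not
proved here). Dimension `n ≥ 2` as for the converse (`isHCobordant_sphere_of_boundsContractible`);
not used for Theorem 1.1. [cite: KervaireMilnorAnnals1963, Lemma 2.3 (p. 506), direction ⇒] -/
def boundsContractible_of_isHCobordant_sphere : Prop :=
  ∀ (n : ℕ) (M : Type) [TopologicalSpace M] [T2Space M] [SecondCountableTopology M]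
    [ChartedSpace (𝔼 n) M] [IsManifold (𝓡 n) ∞ M] [CompactSpace M] [SimplyConnectedSpace M],
    2 ≤ n → IsHCobordant n M (𝕊 n) → BoundsContractible n M

/-- **Kervaire–Milnor's Lemma 2.3 as printed** (Ann. of Math. 77 (1963), p. 506): for a closed
simply connected smooth `n`-manifold `M`, `n ≥ 2`, `M` is h-cobordant to `𝕊ⁿ` iff `M` bounds a
contractible manifold — GIVEN the two directions `isHCobordant_sphere_of_boundsContractible` and
`boundsContractible_of_isHCobordant_sphere` (named facts). [cite: KervaireMilnorAnnals1963, Lemma 2.3 (p. 506)] -/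
theorem isHCobordant_sphere_iff_boundsContractible_of
    (h : isHCobordant_sphere_of_boundsContractible)
    (h' : boundsContractible_of_isHCobordant_sphere) (n : ℕ) (M : Type) [TopologicalSpace M]
    [T2Space M] [SecondCountableTopology M] [ChartedSpace (𝔼 n) M] [IsManifold (𝓡 n) ∞ M]
    [CompactSpace M] [SimplyConnectedSpace M] (hn : 2 ≤ n) :
    IsHCobordant n M (𝕊 n) ↔ BoundsContractible n M :=
  ⟨h' n M hn, h n M hn⟩

/-! ### Named facts: Kervaire–Milnor's Lemma 2.4 -/

/-- **Kervaire–Milnor's Lemma 2.4** (*Groups of homotopy spheres I*, Ann. of Math. 77 (1963),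
p. 507): "If `M` is a homotopy sphere, then `M # (-M)` bounds a contractible manifold." Relational
form over the tree's `IsOrientedConnectedSum`, for *every* oriented connected sum: if the closed
smooth oriented `n`-manifold `(P, oP)`, `n ≥ 2`, is an oriented connected sum of a homotopy sphere
`(Σ, o)` and its reverse `(Σ, -o)`, then `P` bounds a contractible manifold. Kervaire–Milnor's
`M # (-M)` is well defined up to orientation-preserving diffeomorphism by their Lemma 2.1 (disc
theorem of Palais and Cerf), so the printed lemma is this statement; the construction in its
proof handles the one sum formed with a single disc `i : Dⁿ → M` on both sides
(`HomotopySphere.exists_isOrientedConnectedSum_neg_boundsContractible`), and the passage to an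
arbitrary sum is Lemma 2.1 (`boundsContractible_of_isOrientedConnectedSum_neg_of_exists`).
Printed proof: `W = (M - i(½D̊ⁿ)) × [0, π] ∪ Sⁿ⁻¹ × H²` with `i(tu) × θ ∼ u × ((2t-1) sin θ,
(2t-1) cos θ)` ("rotating" `M - Int i(½Dⁿ)` through 180° around its boundary) has
`bW = M # (-M)` and deformation retracts onto the contractible `M - Int i(½Dⁿ)`. Dimension `n ≥ 2`:
the range of the target fact `isHCobordant_sphere_of_isOrientedConnectedSum_neg` (for `n ≥ 3`,
`M - Int i(½Dⁿ)` is contractible by Seifert–van Kampen, Mayer–Vietoris and Whitehead; `n = 2`: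
classification of surfaces). [cite: KervaireMilnorAnnals1963, Lemma 2.4 (p. 507)] -/
def HomotopySphere.boundsContractible_of_isOrientedConnectedSum_neg : Prop :=
  ∀ (n : ℕ) (S : HomotopySphere n) (P : Type) [TopologicalSpace P] [T2Space P]
    [SecondCountableTopology P] [ChartedSpace (𝔼 n) P] [IsManifold (𝓡 n) ∞ P] [CompactSpace P]
    (oP : SmoothOrientation (𝓡 n) P), 2 ≤ n →
    IsOrientedConnectedSum S.orientation (-S.orientation) oP → BoundsContractible n P

/-- **Kervaire–Milnor's Lemma 2.4, existential form** (what the construction on p. 507 yields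
before Lemma 2.1 is invoked): for every homotopy `n`-sphere `(Σ, o)`, `n ≥ 2`, *some* closed smooth
oriented `n`-manifold `(P, oP)` is an oriented connected sum of `(Σ, o)` and `(Σ, -o)` and bounds a
contractible manifold — namely `bW` for the manifold `W` obtained by rotating `Σ - Int i(½Dⁿ)`
through 180° around its boundary, `i : Dⁿ → Σ` an orientation-preserving disc (Kervaire–Milnor,
*Groups of homotopy spheres I* (1963), Lemma 2.4 and its proof, p. 507). `P : Type`, as the
carriers of homotopy spheres. [cite: KervaireMilnorAnnals1963, Lemma 2.4 (p. 507), proof] -/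
def HomotopySphere.exists_isOrientedConnectedSum_neg_boundsContractible : Prop :=
  ∀ (n : ℕ) (S : HomotopySphere n), 2 ≤ n →
    ∃ (P : Type) (_ : TopologicalSpace P) (_ : T2Space P) (_ : SecondCountableTopology P)
      (_ : ChartedSpace (𝔼 n) P) (_ : IsManifold (𝓡 n) ∞ P) (_ : CompactSpace P)
      (oP : SmoothOrientation (𝓡 n) P),
      IsOrientedConnectedSum S.orientation (-S.orientation) oP ∧ BoundsContractible n P

/-- **Lemma 2.4 for every sum from Lemma 2.4 for one sum and Lemma 2.1.** GIVEN the existential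
form of Kervaire–Milnor's Lemma 2.4 (`exists_isOrientedConnectedSum_neg_boundsContractible`) and
the uniqueness of oriented connected sums of connected oriented manifolds up to
orientation-preserving diffeomorphism (tree fact
`exists_diffeomorph_isOrientationPreserving_of_isOrientedConnectedSum`; Kervaire–Milnor 1963,
Lemma 2.1, "well defined", by the disc theorem of Palais and Cerf), every oriented connected sum
`P` of `(Σ, o)` and `(Σ, -o)` bounds a contractible manifold: `P ≅ P₀` for the sum `P₀ = bW` of the
construction, and a null-cobordism is transported along a diffeomorphism of the boundary
(`BoundsContractible.of_diffeomorph`). Homotopy `n`-spheres, `n ≠ 0`, are connected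
(`HomotopySphere.connectedSpace`). [cite: KervaireMilnorAnnals1963, Lemmas 2.1 and 2.4 (pp. 505, 507)] -/
theorem HomotopySphere.boundsContractible_of_isOrientedConnectedSum_neg_of_exists
    (h24 : HomotopySphere.exists_isOrientedConnectedSum_neg_boundsContractible)
    (hPC : ∀ (n : ℕ) (S : HomotopySphere n) (P P' : Type) [TopologicalSpace P] [T2Space P]
      [SecondCountableTopology P] [ChartedSpace (𝔼 n) P] [IsManifold (𝓡 n) ∞ P] [CompactSpace P]
      [TopologicalSpace P'] [T2Space P'] [SecondCountableTopology P'] [ChartedSpace (𝔼 n) P']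
      [IsManifold (𝓡 n) ∞ P'] [CompactSpace P'],
      exists_diffeomorph_isOrientationPreserving_of_isOrientedConnectedSum (IM := 𝓡 n)
        (IN := 𝓡 n) (IP := 𝓡 n) (IP' := 𝓡 n) (M := S.carrier) (N := S.carrier)
        (P := P) (P' := P')) :
    HomotopySphere.boundsContractible_of_isOrientedConnectedSum_neg := by
  intro n S P _ _ _ _ _ _ oP h2 hP
  obtain ⟨P₀, _, _, _, _, _, _, oP₀, hP₀, hB⟩ := h24 n S h2
  haveI := S.connectedSpace (by omega)
  obtain ⟨e, -⟩ := hPC n S P P₀ hP hP₀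
  exact hB.of_diffeomorph e.symm

/-! ### One level down: the smooth constructions and the homotopy theory in Lemmas 2.3–2.4

Each of the two lemmas is a smooth construction followed by a homotopy-theoretic verification.
The four named facts below separate them, and the two reductions after them prove Lemma 2.3
(`⇐`) and the existential Lemma 2.4 from these parts, so that the smooth halves (pure
differential topology: removing an open ball from the interior of a manifold with boundary;
Kervaire–Milnor's rotation of `Σ - Int Dⁿ` about its boundary) and the homotopy halves (excision,
Poincaré duality and Whitehead's theorem; contractibility of a punctured homotopy sphere) can be
proved independently. -/

/-- **Removing an open ball from the interior of a bounding manifold gives a cobordism to the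
sphere** (Kervaire–Milnor, *Groups of homotopy spheres I* (1963), proof of Lemma 2.3, p. 506:
"if `M = bW'` …, then removing the interior of an imbedded disk we obtain a … manifold `W` with
`bW = M + (-Sⁿ)`"; Milnor, *Lectures on the h-cobordism theorem* (1965), §1). Precisely: for a
null-cobordism `M = ∂W'` of a nonempty closed smooth `n`-manifold `M` (tree structure
`NullCobordism`), there are a smooth embedding `i : ℝⁿ⁺¹ → W'` with image in the interior
`Int W'` ("an imbedded open disk") and a cobordism `(W; M, 𝕊ⁿ)` (tree structure `Cobordism`) whose
total space is identified, by a homeomorphism `h`, with the complement `W' ∖ i(B̊ⁿ⁺¹)` of the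
image of the open unit ball, in such a way that the incoming end is the boundary inclusion
`M = ∂W' ↪ W'` and the outgoing end is `i` restricted to the unit sphere `𝕊ⁿ ⊆ ℝⁿ⁺¹`. (`M`
nonempty guarantees `Int W' ≠ ∅`.) Only the topological identification `h` is recorded, which
is what the homotopy-theoretic half `NullCobordism.isHomotopyEquiv_compl_ball_of_contractibleSpace`
consumes; the smooth structure of `W` is that of a codimension-`0` submanifold with boundary of
`W'`. `M : Type`, as the ends of a `Cobordism` share a universe with `𝕊ⁿ : Type`.
[cite: KervaireMilnorAnnals1963, Lemma 2.3, proof (p. 506)] [cite: MilnorHCobordism1965, §1] -/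
def NullCobordism.exists_cobordism_sphere_compl_ball : Prop :=
  ∀ (n : ℕ) (M : Type) [TopologicalSpace M] [T2Space M] [SecondCountableTopology M]
    [ChartedSpace (𝔼 n) M] [IsManifold (𝓡 n) ∞ M] [CompactSpace M] [Nonempty M]
    (c : NullCobordism n M),
    ∃ (i : 𝔼 (n + 1) → c.W) (d : Cobordism n M (𝕊 n))
      (h : d.W ≃ₜ {w : c.W // w ∉ i '' Metric.ball (0 : 𝔼 (n + 1)) 1}),
      Manifold.IsSmoothEmbedding 𝓘(ℝ, 𝔼 (n + 1)) (𝓡∂ (n + 1)) ∞ i ∧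
      range i ⊆ (𝓡∂ (n + 1)).interior c.W ∧
      (∀ x : M, (h (d.inl x) : c.W) = c.incl x) ∧ ∀ y : 𝕊 n, (h (d.inr y) : c.W) = i y

/-- **The homotopy theory in Kervaire–Milnor's Lemma 2.3** (*Groups of homotopy spheres I*
(1963), proof of Lemma 2.3, pp. 506–507). Let `M = ∂W'` be a null-cobordism of a closed simply
connected smooth `n`-manifold `M`, `n ≥ 2`, with `W'` contractible, let `i : ℝⁿ⁺¹ → W'` be a smooth
embedding into the interior, and let `K` be (any homeomorphic model `e : K → W'` of) the
complement `W' ∖ i(B̊ⁿ⁺¹)` of the open unit ball. Then the inclusion `f : M → K` of the boundary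
and the embedding `g : 𝕊ⁿ → K` of the unit sphere via `i` are both homotopy equivalences (tree
predicate `Literature.Topology.FourManifolds.IsHomotopyEquiv`: the map underlies a `ContinuousMap.HomotopyEquiv`). Printed
proof: `K` is simply connected (as `W'` is, the disc having codimension `n + 1 ≥ 3`); "Mapping the
homology exact sequence of the pair `(Dⁿ⁺¹, Sⁿ)` into that of the pair `(W', W)`, we see that the
inclusion `Sⁿ → W` induces a homology isomorphism; hence `Sⁿ` is a deformation retract of `W`"
(excision and Whitehead's theorem); "applying the Poincaré duality isomorphism
`Hₖ(W, M) ≅ Hⁿ⁺¹⁻ᵏ(W, Sⁿ)`, we see that the inclusion `M → W` also induces isomorphisms of homology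
groups. Since `M` is simply connected, this completes the proof" (Whitehead's theorem again;
compact manifolds with boundary have the homotopy type of CW complexes). Not in Mathlib or the
tree: Whitehead's theorem, Poincaré–Lefschetz duality for `(W; M, Sⁿ)`.
[cite: KervaireMilnorAnnals1963, Lemma 2.3, proof (pp. 506–507)] -/
def NullCobordism.isHomotopyEquiv_compl_ball_of_contractibleSpace : Prop :=
  ∀ (n : ℕ) (M : Type) [TopologicalSpace M] [T2Space M] [SecondCountableTopology M]
    [ChartedSpace (𝔼 n) M] [IsManifold (𝓡 n) ∞ M] [CompactSpace M] [SimplyConnectedSpace M]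
    (c : NullCobordism n M), 2 ≤ n → ContractibleSpace c.W →
    ∀ (i : 𝔼 (n + 1) → c.W), Manifold.IsSmoothEmbedding 𝓘(ℝ, 𝔼 (n + 1)) (𝓡∂ (n + 1)) ∞ i →
      range i ⊆ (𝓡∂ (n + 1)).interior c.W →
    ∀ (K : Type) [TopologicalSpace K] (e : K → c.W), Topology.IsEmbedding e →
      range e = (i '' Metric.ball (0 : 𝔼 (n + 1)) 1)ᶜ →
    ∀ (f : M → K) (g : (𝕊 n) → K), e ∘ f = c.incl → e ∘ g = i ∘ Subtype.val →
      IsHomotopyEquiv f ∧ IsHomotopyEquiv g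

/-- **Kervaire–Milnor's Lemma 2.3 (`⇐`) from its two halves.** GIVEN the ball-removal cobordism
(`NullCobordism.exists_cobordism_sphere_compl_ball`) and the homotopy theory of the complement
(`NullCobordism.isHomotopyEquiv_compl_ball_of_contractibleSpace`), a closed simply connected
smooth `n`-manifold, `n ≥ 2`, bounding a contractible manifold is h-cobordant to `𝕊ⁿ`: the
cobordism `(W; M, 𝕊ⁿ)` obtained by removing an open ball from the contractible `W'` is an
h-cobordism, homotopy equivalences being transported along the homeomorphism `W ≅ W' ∖ i(B̊ⁿ⁺¹)`
(Kervaire–Milnor 1963, proof of Lemma 2.3, pp. 506–507). A simply connected space is nonempty.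
[cite: KervaireMilnorAnnals1963, Lemma 2.3, proof (pp. 506–507)] -/
theorem isHCobordant_sphere_of_boundsContractible_of
    (h23a : NullCobordism.exists_cobordism_sphere_compl_ball)
    (h23b : NullCobordism.isHomotopyEquiv_compl_ball_of_contractibleSpace) :
    isHCobordant_sphere_of_boundsContractible := by
  intro n M _ _ _ _ _ _ _ hn hB
  obtain ⟨c, hc⟩ := hB
  haveI : Nonempty M := by
    obtain ⟨x⟩ := (inferInstance : PathConnectedSpace M).nonempty
    exact ⟨x⟩
  obtain ⟨i, d, h, hi, hrange, hinl, hinr⟩ := h23a n M c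
  have he : Topology.IsEmbedding (Subtype.val ∘ h : d.W → c.W) :=
    Topology.IsEmbedding.subtypeVal.comp h.isEmbedding
  have hre : range (Subtype.val ∘ h : d.W → c.W) = (i '' Metric.ball (0 : 𝔼 (n + 1)) 1)ᶜ := by
    rw [range_comp, h.range_coe, image_univ, Subtype.range_coe_subtype]
    rfl
  obtain ⟨h1, h2⟩ := h23b n M c hn hc i hi hrange d.W (Subtype.val ∘ h) he hre d.inl d.inr
    (funext hinl) (funext hinr)
  exact ⟨d, h1, h2⟩

/-- **Kervaire–Milnor's rotation construction** (*Groups of homotopy spheres I* (1963), proof of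
Lemma 2.4, p. 507). For a homotopy `n`-sphere `(Σ, o)`, `n ≠ 0`, and an orientation-preserving
disc `i : Dⁿ → Σ`, the manifold `W` obtained from `(Σ - i(½D̊ⁿ)) × [0, π] + Sⁿ⁻¹ × H²` (`H²` the
half-disc of all `(t sin θ, t cos θ)`, `0 ≤ t ≤ 1`, `0 ≤ θ ≤ π`) by identifying `i(tu) × θ` with
`u × ((2t-1) sin θ, (2t-1) cos θ)` for `½ < t ≤ 1`, `0 ≤ θ ≤ π` — "intuitively we are removing the
interior of `i(½Dⁿ)` from `M` and then 'rotating' the result through 180° around the resulting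
boundary" — "is a differentiable manifold with `bW = M # (-M)`. Furthermore `W` contains
`M - Interior i(½Dⁿ)` as deformation retract". Precisely: there are a closed smooth oriented
`n`-manifold `(P, oP)` which is an oriented connected sum of `(Σ, o)` and `(Σ, -o)` (tree
predicate `IsOrientedConnectedSum`), a null-cobordism `P = ∂W` (tree structure `NullCobordism`)
and a point `p ∈ Σ` such that `W` is homotopy equivalent to the punctured homotopy sphere
`Σ ∖ {p}` (which is homotopy equivalent to `Σ - Interior i(½Dⁿ)`, a deformation retract of `W`).
`n ≠ 0`: in dimension `0` there are no unit vectors to glue along and no orientation-reversing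
discs (compare the tree fact `exists_isOrientedConnectedSum`). The homotopy sphere hypothesis is
not used by the construction (any closed connected oriented `M` would do) but is the generality
printed. [cite: KervaireMilnorAnnals1963, Lemma 2.4, proof (p. 507)] -/
def HomotopySphere.exists_nullCobordism_isOrientedConnectedSum_neg : Prop :=
  ∀ (n : ℕ) (S : HomotopySphere n), n ≠ 0 →
    ∃ (P : Type) (_ : TopologicalSpace P) (_ : T2Space P) (_ : SecondCountableTopology P)
      (_ : ChartedSpace (𝔼 n) P) (_ : IsManifold (𝓡 n) ∞ P) (_ : CompactSpace P)
      (oP : SmoothOrientation (𝓡 n) P) (c : NullCobordism n P) (p : S.carrier),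
      IsOrientedConnectedSum S.orientation (-S.orientation) oP ∧
        Nonempty (c.W ≃ₕ {x : S.carrier // x ≠ p})

/-- **A punctured homotopy sphere is contractible** (the homotopy theory in Kervaire–Milnor's
Lemma 2.4; *Groups of homotopy spheres I* (1963), proof of Lemma 2.4, p. 507: "`W` contains
`M - Interior i(½Dⁿ)` as deformation retract, and therefore is contractible"). For a homotopy
`n`-sphere `Σ`, `n ≥ 2`, and any point `p`, the open manifold `Σ ∖ {p}` (homotopy equivalent to
`Σ - Interior i(½Dⁿ)` for a disc `i` centred at `p`) is contractible. Standard argument, not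
spelled out in the source: for `n ≥ 3`, `Σ ∖ {p}` is simply connected (general position; tree
theorem `isSimplyConnected_compl_singleton_of_isOpenEmbedding`) and has the homology of a point
(Mayer–Vietoris for `Σ = (Σ ∖ {p}) ∪ disc` and `H₊(Σ) ≅ H₊(Sⁿ)`), hence is contractible by
Whitehead's theorem (it has the homotopy type of a CW complex); for `n = 2`, `Σ` is diffeomorphic
to `S²` (classification of surfaces) and `S² ∖ {p} ≅ ℝ²`. Whitehead's theorem is not in Mathlib or
the tree. Stated for `n ≥ 2`, the range of the target fact (it happens to hold for `n ≤ 1` too).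
[cite: KervaireMilnorAnnals1963, Lemma 2.4, proof (p. 507)] -/
def HomotopySphere.contractibleSpace_compl_singleton : Prop :=
  ∀ (n : ℕ) (S : HomotopySphere n) (p : S.carrier), 2 ≤ n → ContractibleSpace {x : S.carrier // x ≠ p}

/-- **The existential Lemma 2.4 from its two halves.** GIVEN Kervaire–Milnor's rotation
construction (`HomotopySphere.exists_nullCobordism_isOrientedConnectedSum_neg`) and the
contractibility of punctured homotopy spheres (`HomotopySphere.contractibleSpace_compl_singleton`),
for every homotopy `n`-sphere `Σ`, `n ≥ 2`, some oriented connected sum `Σ # (-Σ)` bounds a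
contractible manifold: the bounding manifold `W` of the construction is homotopy equivalent to
`Σ ∖ {p}`, and contractibility is a homotopy invariant (Mathlib's
`ContinuousMap.HomotopyEquiv.contractibleSpace`). Kervaire–Milnor 1963, proof of Lemma 2.4
(p. 507). [cite: KervaireMilnorAnnals1963, Lemma 2.4, proof (p. 507)] -/
theorem HomotopySphere.exists_isOrientedConnectedSum_neg_boundsContractible_of
    (h24a : HomotopySphere.exists_nullCobordism_isOrientedConnectedSum_neg)
    (h24b : HomotopySphere.contractibleSpace_compl_singleton) :
    HomotopySphere.exists_isOrientedConnectedSum_neg_boundsContractible := by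
  intro n S h2
  obtain ⟨P, _, _, _, _, _, _, oP, c, p, hP, ⟨e⟩⟩ := h24a n S (by omega)
  haveI := h24b n S p h2
  haveI : ContractibleSpace c.W := e.contractibleSpace
  exact ⟨P, ‹_›, ‹_›, ‹_›, ‹_›, ‹_›, ‹_›, oP, hP, c, inferInstance⟩

/-! ### Simple connectivity of sums of homotopy spheres (`n ≥ 3`) -/

namespace HomotopySphere

variable {n : ℕ}

/-- **A connected sum of two homotopy `n`-spheres, `n ≥ 3`, is simply connected**: the summands
are simply connected (`HomotopySphere.simplyConnectedSpace`; `π₁(Sⁿ) = 1` for `n ≥ 2`) and a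
connected sum of simply connected `n`-manifolds, `n ≥ 3`, is simply connected by Seifert–van
Kampen (tree theorem `IsConnectedSum.simplyConnectedSpace_holds`). This is the part of
Kervaire–Milnor's remark "the sum of two homotopy `n`-spheres is a homotopy `n`-sphere" (1963,
§2, p. 505) that Lemma 2.3 consumes; for `n = 2` the punctured summands are not simply connected
a priori and the remark itself (`nonempty_homotopyEquiv_sphere_of_isConnectedSum`) is needed.
[cite: KervaireMilnorAnnals1963, §2 p. 505] -/
theorem simplyConnectedSpace_of_isConnectedSum (h3 : 3 ≤ n) (S T : HomotopySphere n)
    (P : Type*) [TopologicalSpace P] [ChartedSpace (𝔼 n) P]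
    (hP : IsConnectedSum (𝓡 n) (𝓡 n) (𝓡 n) S.carrier T.carrier P) : SimplyConnectedSpace P := by
  haveI := S.simplyConnectedSpace (by omega)
  haveI := T.simplyConnectedSpace (by omega)
  exact IsConnectedSum.simplyConnectedSpace_holds (by rw [finrank_euclideanSpace_fin]; omega) hP

/-- An oriented connected sum `Σ # (-Σ)` of a homotopy `n`-sphere and its reverse, `n ≥ 2`, is
simply connected, GIVEN — for `n = 2` only — Kervaire–Milnor's remark that sums of homotopy
spheres are homotopy spheres (`nonempty_homotopyEquiv_sphere_of_isConnectedSum`, 1963, §2,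
p. 505): for `n ≥ 3` this is `simplyConnectedSpace_of_isConnectedSum`, for `n = 2` the sum is a
homotopy `2`-sphere, simply connected by `HomotopySphere.simplyConnectedSpace`.
[cite: KervaireMilnorAnnals1963, §2 p. 505] -/
theorem simplyConnectedSpace_of_isOrientedConnectedSum_neg
    (hK1 : nonempty_homotopyEquiv_sphere_of_isConnectedSum) (h2 : 2 ≤ n) (S : HomotopySphere n)
    (P : Type) [TopologicalSpace P] [T2Space P] [SecondCountableTopology P] [ChartedSpace (𝔼 n) P]
    [IsManifold (𝓡 n) ∞ P] [CompactSpace P] (oP : SmoothOrientation (𝓡 n) P)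
    (hP : IsOrientedConnectedSum S.orientation (-S.orientation) oP) : SimplyConnectedSpace P := by
  by_cases h3 : 3 ≤ n
  · exact simplyConnectedSpace_of_isConnectedSum h3 S S.neg P hP.isConnectedSum
  · obtain ⟨e⟩ := hK1 n S S.neg P hP.isConnectedSum
    exact HomotopySphere.simplyConnectedSpace h2 ⟨P, oP, ⟨e⟩⟩

/-! ### Assembly: the target fact from Lemmas 2.3 and 2.4 -/

/-- **`Σ # (-Σ)` is h-cobordant to `𝕊ⁿ` in dimensions `n ≥ 3`, from Kervaire–Milnor's Lemmas 2.3
and 2.4** (1963, proof of Thm 1.1, p. 507: "By Lemmas 2.3, 2.4, each element of `Θₙ` has an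
inverse"): GIVEN Lemma 2.3 (`⇐`, `isHCobordant_sphere_of_boundsContractible`) and Lemma 2.4
(`boundsContractible_of_isOrientedConnectedSum_neg`), every oriented connected sum `P` of a
homotopy `n`-sphere `Σ`, `n ≥ 3`, and `-Σ` is h-cobordant to `𝕊ⁿ`; the simple connectivity of
`P` required by Lemma 2.3 is the theorem `simplyConnectedSpace_of_isConnectedSum`.
[cite: KervaireMilnorAnnals1963, Lemmas 2.3–2.4 and proof of Thm. 1.1 (pp. 506–507)] -/
theorem isHCobordant_sphere_of_isOrientedConnectedSum_neg_of_three_le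
    (h23 : isHCobordant_sphere_of_boundsContractible)
    (h24 : boundsContractible_of_isOrientedConnectedSum_neg) (h3 : 3 ≤ n) (S : HomotopySphere n)
    (P : Type) [TopologicalSpace P] [T2Space P] [SecondCountableTopology P] [ChartedSpace (𝔼 n) P]
    [IsManifold (𝓡 n) ∞ P] [CompactSpace P] (oP : SmoothOrientation (𝓡 n) P)
    (hP : IsOrientedConnectedSum S.orientation (-S.orientation) oP) :
    Literature.Topology.FourManifolds.IsHCobordant n P (𝕊 n) := by
  haveI := simplyConnectedSpace_of_isConnectedSum h3 S S.neg P hP.isConnectedSum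
  exact h23 n P (by omega) (h24 n S P oP (by omega) hP)

/-- **The target fact from Kervaire–Milnor's Lemmas 2.3 and 2.4.** The named fact
`HomotopySphere.isHCobordant_sphere_of_isOrientedConnectedSum_neg` (`Σ # (-Σ)` is h-cobordant to
`𝕊ⁿ`, `n ≥ 2`; `HomotopySpheresGroup.lean`) follows from Lemma 2.3 (`⇐`,
`isHCobordant_sphere_of_boundsContractible`), Lemma 2.4
(`boundsContractible_of_isOrientedConnectedSum_neg`) and, in dimension `n = 2` only, the simple
connectivity of the sums `Σ # (-Σ)` of homotopy `2`-spheres (hypothesis `h2sc`, the residue of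
the hypothesis of Lemma 2.3 not covered by Seifert–van Kampen; for `n ≥ 3` see
`isHCobordant_sphere_of_isOrientedConnectedSum_neg_of_three_le`, and for `h2sc` from the p. 505
remark see `isHCobordant_sphere_of_isOrientedConnectedSum_neg_of`). This is the sentence "By
Lemmas 2.3, 2.4, each element of `Θₙ` has an inverse" of the proof of Theorem 1.1
(Kervaire–Milnor 1963, p. 507), up to Smale's theorem which the consumer
`HomotopySphereClass.exists_isMul_neg_of` adds. [cite: KervaireMilnorAnnals1963, Lemmas 2.3–2.4 and proof of Thm. 1.1 (pp. 506–507)] -/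
theorem isHCobordant_sphere_of_isOrientedConnectedSum_neg_of'
    (h23 : isHCobordant_sphere_of_boundsContractible)
    (h24 : boundsContractible_of_isOrientedConnectedSum_neg)
    (h2sc : ∀ (S : HomotopySphere 2) (P : Type) [TopologicalSpace P] [T2Space P]
      [SecondCountableTopology P] [ChartedSpace (𝔼 2) P] [IsManifold (𝓡 2) ∞ P] [CompactSpace P]
      (oP : SmoothOrientation (𝓡 2) P),
      IsOrientedConnectedSum S.orientation (-S.orientation) oP → SimplyConnectedSpace P) :
    isHCobordant_sphere_of_isOrientedConnectedSum_neg := by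
  intro n S P _ _ _ _ _ _ oP h2 hP
  by_cases h3 : 3 ≤ n
  · exact isHCobordant_sphere_of_isOrientedConnectedSum_neg_of_three_le h23 h24 h3 S P oP hP
  · obtain rfl : n = 2 := by omega
    haveI := h2sc S P oP hP
    exact h23 2 P le_rfl (h24 2 S P oP le_rfl hP)

/-- **The target fact from Kervaire–Milnor's Lemmas 2.3 and 2.4 and the p. 505 remark.** As
`isHCobordant_sphere_of_isOrientedConnectedSum_neg_of'`, with the simple connectivity of the
`2`-dimensional sums `Σ # (-Σ)` supplied by Kervaire–Milnor's remark that sums of homotopy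
spheres are homotopy spheres (tree fact `nonempty_homotopyEquiv_sphere_of_isConnectedSum`, 1963,
§2, p. 505; `simplyConnectedSpace_of_isOrientedConnectedSum_neg`), which is how the printed proof
of Theorem 1.1 (p. 507) meets the hypothesis of Lemma 2.3.
[cite: KervaireMilnorAnnals1963, Lemmas 2.3–2.4, proof of Thm. 1.1 (pp. 506–507) and p. 505] -/
theorem isHCobordant_sphere_of_isOrientedConnectedSum_neg_of
    (h23 : isHCobordant_sphere_of_boundsContractible)
    (h24 : boundsContractible_of_isOrientedConnectedSum_neg)
    (hK1 : nonempty_homotopyEquiv_sphere_of_isConnectedSum) :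
    isHCobordant_sphere_of_isOrientedConnectedSum_neg :=
  isHCobordant_sphere_of_isOrientedConnectedSum_neg_of' h23 h24 fun S P _ _ _ _ _ _ oP hP =>
    simplyConnectedSpace_of_isOrientedConnectedSum_neg hK1 le_rfl S P oP hP

end HomotopySphere

end Literature.Topology.FourManifolds
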